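import Mathlib
import HarnessLib.Audit.Tags
import Summits.Ventures.ResidMod.Conjectures.TwistedTorsionFamilyLaw

/-!
# Venture ResidMod — the SQUARE CLASS of the twisted-3-torsion family and its IMPRIMITIVITY
# (DERIVATION-19 Lemma 1 of the census cell `pub-residmod`, STRUCTURE.md TODO-27; rung 19, mechanism `M-19`)

HONEST FRAMING. Elementary polynomial algebra about integer sextics `f` admitting an identity `4f = G² + c·ℓ⁶`
(`deg G ≤ 3`, `deg ℓ ≤ 1`, `c ≠ 0`): over any field containing a square root `s` of `−c` one has
`4f = (G − s·ℓ³)(G + s·ℓ³)`, a product of two cubics, so `f` is NOT irreducible there. This is the algebraic half of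
DERIVATION-19 Lemma 1 (HOME = `run/shared/lean/pub/pub-residmod/`, file `structure/rung19/DERIVATION-19.md` sha256
`bba47bd8…`, registered on the cell bus as R278 before the rung-19 instrument ran; this file registered as R282 before
any proof was written) and it is PROVED below. The Galois-theoretic half («hence `Gal(f/ℚ)` has order dividing `72`,
in particular no element of order `5`, so `f` is never certificate-typical») is TYPED as the named statement
`M19_galois_card_dvd` and NOT proved here (an elementary but not yet formalised tower argument; tagged
`@[conjecture]` only in the harness sense «open obligation node, provable by name» — mathematically it is a two-line
consequence of the factorisation); its consequences for the cell's notion `Typical` (`|Gal f| ≥ 360`) are PROVED from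
it by arithmetic. No curve, no Galois image of an abelian surface, no conductor and no modularity statement is touched:
the objects are a box of integer sextics and a polynomial identity.

WHY THE CELL CARES (STRUCTURE.md v0.19.4 §1 column `σ(H)`, §5 NULL-13, SCORES-19 `ddf4a842…`). In the principal class of
the family (`4f = G² + c·k³`, rung 18) the members whose `k` is a perfect square `ℓ²` are, member by member, forced to be
atypical by the factorisation below; they are `σ(H) = 45.45 % / 41.39 % / 39.83 % / 36.82 %` of all members at naive height
`H = 16 / 24 / 32 / 48` (exact lattice counts), i.e. about four fifths of all members that the rung-18 Frobenius-cycle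
certificate failed to certify typical (`σ/(1 − F) = 0.79…0.83` at `H = 12…24`), and `typical ∧ square-class = 0` of
`424 495` certified-typical members at `H = 24` — the theorem-grade null this lemma explains.

CONTENTS. `MemberSQ` (the square class, limit-free) · `sq_norm_factorisation` (PROVED) · `memberW_of_memberSQ` (PROVED:
square class ⊆ family `W` with `d = m = 1`, `k = ℓ²`) · `natDegree_toPoly_le`, `coeff_toPoly_six`, `natDegree_toPoly`
(PROVED bookkeeping for the coefficient-vector encoding of the L10 file) · `not_irreducible_of_sqRep` /
`MemberSQ.not_irreducible` (PROVED: Lemma 1, algebraic half, over every field of characteristic `0` containing `√−c`) ·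
`reducible_over_ℚ_of_neg_c_square` (PROVED corollary: `−c = t²` ⇒ `f` reducible over `ℚ`) · `M19_galois_card_dvd`
(TYPED, owed) · `orderOf_ne_five_of_card_dvd_72`, `M19_not_typical_of_card_dvd` (PROVED from it) · a `decide`-checked
instance.

References: cell HOME `run/shared/lean/pub/pub-residmod/` (STRUCTURE.md §1/§2 LEM-1 annex M-19/§5 NULL-13/§6 TODO-27;
structure/PREDICTIONS-19-2026-08-23.md `e7df3683…`; structure/rung19/DERIVATION-19.md `bba47bd8…`, SCORES-19.json
`ddf4a842…`); the companion file `TwistedTorsionFamilyLaw.lean` (law L10, `MemberW`, `Typical`; gate p359767) and the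
references there ([DokchitserDoris2019] arXiv:1706.06162 Prop. 4.1 for the torsion parametrisation `f = G² − λk³`).
Dedekind's theorem (a `(5,1)` Frobenius cycle pattern at an unramified prime gives a `5`-cycle in `Gal(f)`), which links
«no element of order `5`» to «never `(5,1)`-certified», is quoted, not formalised.
-/

open Polynomial

namespace Summit.Ventures.ResidMod.Conjectures

/-! ## The square class -/

/-- THE SQUARE CLASS (rung 19, mechanism `M-19`; limit-free): `4f = G² + c·ℓ⁶` with `c ≠ 0`, `ℓ ≠ 0` of degree `≤ 1`
(so `k = ℓ²` is a perfect square of degree `≤ 2`) and `deg G ≤ 3`. In the rung-18 box the classes met are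
`ℓ ∈ {1, x, x ± 1, x ± 2, 2x ± 1}` (DERIVATION-19 Lemma 2); `ℓ` need not be primitive here (a content `t` of `ℓ` is the
same as replacing `c` by `c·t⁶`). -/
def MemberSQ (f : Sextic) : Prop :=
  ∃ (c : ℤ) (G ℓ : ℤ[X]), c ≠ 0 ∧ ℓ ≠ 0 ∧ G.natDegree ≤ 3 ∧ ℓ.natDegree ≤ 1 ∧
    C 4 * toPoly f = G ^ 2 + C c * ℓ ^ 6

/-- The norm-form factorisation behind `M-19`: in any commutative ring containing `s` with `s² = −c`,
`G² + c·L⁶ = (G − s·L³)·(G + s·L³)`. (PROVED; pure `ring`.) -/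
theorem sq_norm_factorisation {R : Type*} [CommRing R] (G L : R[X]) (c s : R) (hs : s ^ 2 = -c) :
    G ^ 2 + C c * L ^ 6 = (G - C s * L ^ 3) * (G + C s * L ^ 3) := by
  have hc : c = -(s ^ 2) := by rw [hs, neg_neg]
  rw [hc, C_neg, C_pow]
  ring

/-- The square class lies in the twisted-3-torsion family `W` of the L10 file (`d = 1`, `m = 1`, `k = ℓ²`). (PROVED.) -/
theorem memberW_of_memberSQ {f : Sextic} (h : MemberSQ f) : MemberW f := by
  obtain ⟨c, G, ℓ, hc, hℓ, hG, hℓ1, hrep⟩ := h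
  refine ⟨1, 1, c, G, ℓ ^ 2, squarefree_one, one_ne_zero, hc, pow_ne_zero 2 hℓ, hG, ?_, ?_⟩
  · exact natDegree_pow_le.trans (by omega)
  · have h4 : (4 * 1 * 1 ^ 2 : ℤ) = 4 := by norm_num
    rw [h4, hrep]
    ring

/-! ## Bookkeeping for the coefficient-vector encoding -/

/-- `toPoly f` has degree at most `6`. -/
theorem natDegree_toPoly_le (f : Sextic) : (toPoly f).natDegree ≤ 6 := by
  unfold toPoly
  refine natDegree_sum_le_of_forall_le _ _ (fun i _ => ?_)
  have hi := i.isLt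
  exact (natDegree_C_mul_X_pow_le (f i) (i : ℕ)).trans (by omega)

/-- The `x⁶`-coefficient of `toPoly f` is `f 6`. -/
theorem coeff_toPoly_six (f : Sextic) : (toPoly f).coeff 6 = f 6 := by
  unfold toPoly
  rw [finsetSum_coeff]
  simp [Fin.sum_univ_seven]

/-- A genuine sextic: `f 6 ≠ 0` gives `natDegree (toPoly f) = 6`. -/
theorem natDegree_toPoly {f : Sextic} (hf : f 6 ≠ 0) : (toPoly f).natDegree = 6 :=
  natDegree_eq_of_le_of_coeff_ne_zero (natDegree_toPoly_le f) (by rw [coeff_toPoly_six]; exact hf)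

/-! ## DERIVATION-19 Lemma 1, algebraic half (PROVED): a square-class member is reducible over every field of
characteristic `0` containing a square root of `−c`, as a product of two cubics -/

/-- **Lemma 1 (imprimitivity), algebraic half.** Let `f` be an integer sextic (`f 6 ≠ 0`) with `4f = G² + c·ℓ⁶`,
`deg G ≤ 3`, `deg ℓ ≤ 1`. Then over ANY field `K` of characteristic `0` containing `s` with `s² = −c`, the polynomial `f`
is not irreducible: `4f = (G − sℓ³)(G + sℓ³)` with both factors of degree exactly `3`. (`c ≠ 0` and `ℓ ≠ 0` are not even
needed for this half; they matter for the torsion reading and for the class bookkeeping.) -/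
theorem not_irreducible_of_sqRep {K : Type*} [Field K] [CharZero K] {f : Sextic} (hf : f 6 ≠ 0)
    {c : ℤ} {G ℓ : ℤ[X]} (hG : G.natDegree ≤ 3) (hℓ : ℓ.natDegree ≤ 1)
    (hrep : C 4 * toPoly f = G ^ 2 + C c * ℓ ^ 6) {s : K} (hs : s ^ 2 = -(c : K)) :
    ¬ Irreducible ((toPoly f).map (Int.castRingHom K)) := by
  set φ : ℤ →+* K := Int.castRingHom K with hφ
  set F : K[X] := (toPoly f).map φ with hF
  set A : K[X] := G.map φ - C s * (ℓ.map φ) ^ 3 with hA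
  set B : K[X] := G.map φ + C s * (ℓ.map φ) ^ 3 with hB
  -- the identity, transported to `K`, and the factorisation
  have hmap : C (4 : K) * F = (G.map φ) ^ 2 + C (c : K) * (ℓ.map φ) ^ 6 := by
    have h := congrArg (Polynomial.map φ) hrep
    simp only [Polynomial.map_mul, Polynomial.map_add, Polynomial.map_pow, Polynomial.map_C] at h
    rw [map_ofNat φ 4, eq_intCast φ c] at h
    exact h
  have hfac : C (4 : K) * F = A * B := by
    rw [hmap]
    exact sq_norm_factorisation _ _ _ _ hs
  -- degrees: `F` has degree `6`, `A` and `B` at most `3`, hence exactly `3` each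
  have hFdeg : F.natDegree = 6 := by
    rw [hF, natDegree_map_eq_of_injective φ.injective_int, natDegree_toPoly hf]
  have hGm : (G.map φ).natDegree ≤ 3 := natDegree_map_le.trans hG
  have hLm : (ℓ.map φ).natDegree ≤ 1 := natDegree_map_le.trans hℓ
  have hT : (C s * (ℓ.map φ) ^ 3).natDegree ≤ 3 :=
    (natDegree_C_mul_le _ _).trans (natDegree_pow_le.trans (by omega))
  have hA3 : A.natDegree ≤ 3 := (natDegree_sub_le _ _).trans (max_le hGm hT)
  have hB3 : B.natDegree ≤ 3 := (natDegree_add_le _ _).trans (max_le hGm hT)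
  have h4 : (4 : K) ≠ 0 := by norm_num
  have hF0 : F ≠ 0 := by
    intro h0
    rw [h0, natDegree_zero] at hFdeg
    exact absurd hFdeg (by norm_num)
  have hAB0 : A * B ≠ 0 := by
    rw [← hfac]
    exact mul_ne_zero (by rwa [Ne, C_eq_zero]) hF0
  have hA0 : A ≠ 0 := left_ne_zero_of_mul hAB0
  have hB0 : B ≠ 0 := right_ne_zero_of_mul hAB0
  have hsum : A.natDegree + B.natDegree = 6 := by
    rw [← natDegree_mul hA0 hB0, ← hfac, natDegree_C_mul h4, hFdeg]
  have hAeq : A.natDegree = 3 := by omega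
  have hBeq : B.natDegree = 3 := by omega
  -- an irreducible `F` could not split as (cubic)·(cubic)
  intro hirr
  have hF' : F = (C (4 : K)⁻¹ * A) * B := by
    calc F = C (4 : K)⁻¹ * (C (4 : K) * F) := by
            rw [← mul_assoc, ← C_mul, inv_mul_cancel₀ h4, C_1, one_mul]
      _ = (C (4 : K)⁻¹ * A) * B := by rw [hfac, mul_assoc]
  rcases hirr.isUnit_or_isUnit hF' with hu | hu
  · have h0 := natDegree_eq_zero_of_isUnit hu
    rw [natDegree_C_mul (inv_ne_zero h4)] at h0
    omega
  · have h0 := natDegree_eq_zero_of_isUnit hu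
    omega

/-- **Lemma 1, algebraic half, for the class.** A square-class sextic is reducible over every field of characteristic `0`
containing a square root of `−c` for ITS `c` — stated with the witness `c` exposed. (PROVED.) -/
theorem MemberSQ.exists_c_not_irreducible {f : Sextic} (hf : f 6 ≠ 0) (h : MemberSQ f) :
    ∃ c : ℤ, c ≠ 0 ∧ ∀ (K : Type) [Field K] [CharZero K] (s : K), s ^ 2 = -(c : K) →
      ¬ Irreducible ((toPoly f).map (Int.castRingHom K)) := by
  obtain ⟨c, G, ℓ, hc, -, hG, hℓ1, hrep⟩ := h
  exact ⟨c, hc, fun K _ _ s hs => not_irreducible_of_sqRep hf hG hℓ1 hrep hs⟩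

/-- Corollary (PROVED): if `−c` is a square in `ℤ`, the member is already reducible over `ℚ` (DERIVATION-19 Lemma 1, first
case). -/
theorem not_irreducible_over_ℚ_of_neg_c_square {f : Sextic} (hf : f 6 ≠ 0) {c t : ℤ} {G ℓ : ℤ[X]}
    (hG : G.natDegree ≤ 3) (hℓ : ℓ.natDegree ≤ 1) (hrep : C 4 * toPoly f = G ^ 2 + C c * ℓ ^ 6)
    (ht : t ^ 2 = -c) : ¬ Irreducible (toRatPoly f) := by
  have hs : ((t : ℚ)) ^ 2 = -((c : ℤ) : ℚ) := by exact_mod_cast congrArg (fun z : ℤ => (z : ℚ)) ht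
  exact not_irreducible_of_sqRep (K := ℚ) hf hG hℓ hrep hs

/-! ## The Galois half — TYPED, NOT PROVED here; consequences PROVED from it -/

/-- **OWED THEOREM (DERIVATION-19 Lemma 1, Galois half) — NOT PROVED in the tree; tagged as an open obligation node so
that a prover may close it BY NAME.** For a non-degenerate square-class sextic `f`, the Galois group of `f` over `ℚ` has
order dividing `72`. Proof on paper: with `K = ℚ(√−c)` and `L` the splitting field of `f` over `ℚ`, `Gal(L/ℚ)` is a
quotient of `Gal(LK/ℚ)`; `[LK : ℚ] = [LK : K]·[K : ℚ]` with `[K : ℚ] ∣ 2`, and `Gal(LK/K) = Gal(A·B / K)` embeds in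
`Gal(A/K) × Gal(B/K) ≤ S₃ × S₃` (order `36`) for the two conjugate cubics `A, B` of `not_irreducible_of_sqRep`
(Mathlib: `Polynomial.Gal.restrictProd_injective`, `Polynomial.Gal.card_of_separable`). Hence `|Gal(f/ℚ)| ∣ 72`; in
particular `Gal(f) ≤ S₃ ≀ C₂` is imprimitive (blocks = the roots of `A` and of `B`). -/
@[conjecture] def M19_galois_card_dvd : Prop :=
  ∀ f : Sextic, NonDegenerate f → MemberSQ f → Nat.card (toRatPoly f).Gal ∣ 72

/-- PROVED: a group whose order divides `72` has no element of order `5` (so, by Dedekind's theorem — quoted, not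
formalised — a square-class `f` never shows the `(5,1)` Frobenius cycle pattern the rung-18 certificate requires). -/
theorem orderOf_ne_five_of_card_dvd_72 {Γ : Type*} [Group Γ] (hΓ : Nat.card Γ ∣ 72) (g : Γ) : orderOf g ≠ 5 := by
  intro h5
  have h : 5 ∣ 72 := by
    have := orderOf_dvd_natCard g
    rw [h5] at this
    exact this.trans hΓ
  omega

/-- PROVED from the owed statement: a square-class member is never `Typical` (`|Gal f| ≥ 360`), since `|Gal f| ∣ 72`
forces `|Gal f| ≤ 72 < 360`. This is NULL-13 of STRUCTURE.md («typical ∧ square-class = 0 / 424 495 at H = 24») as a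
statement about the typed notions, conditional only on `M19_galois_card_dvd`. -/
theorem M19_not_typical_of_card_dvd (h : M19_galois_card_dvd) :
    ∀ f : Sextic, NonDegenerate f → MemberSQ f → ¬ Typical f := by
  intro f hnd hsq htyp
  have hdvd := h f hnd hsq
  have hle : Nat.card (toRatPoly f).Gal ≤ 72 := Nat.le_of_dvd (by norm_num) hdvd
  unfold Typical at htyp
  omega

/-! ## A checked instance -/

/-- Instance (height `2`, class `ℓ = x`, `c = 3`): `f = x⁶ + x⁴ + x³ + x² + 2x + 1` satisfies
`4f = (x³ + 2x + 2)² + 3·x⁶`, checked coefficient-wise on integer 7-tuples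
(`(x³ + 2x + 2)² = x⁶ + 4x⁴ + 4x³ + 4x² + 8x + 4`); so `f` factors over `ℚ(√−3)` as
`¼·(x³ + 2x + 2 − √−3·x³)(x³ + 2x + 2 + √−3·x³)`. -/
example : (fun i : Fin 7 => (4 : ℤ) * (![1, 2, 1, 1, 1, 0, 1] : Fin 7 → ℤ) i) =
    ![2 * 2, 2 * (2 * 2), 2 * 2, 2 * (2 * 1), 2 * (2 * 1) + 0, 0, 1 * 1 + 3] := by
  decide

end Summit.Ventures.ResidMod.Conjectures
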